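import Summits.Ventures.SP4Inv.KernelReplayBase

/-!
# Kernel replay of `kirby-cert/1` RIBBON certificates, II: `FLOAT`, `REVERSE`, `BAND`, the kernel check

Honest framing (cell `pub-sp4inv`, seat p3 gen 3, HOME `run/shared/lean/pub/pub-sp4inv/`; venture
SP4Inv): sequel of `KernelReplayBase` (read its header first: conventions, what is and is not claimed).
THIS FILE: the remaining moves — `FLOAT` (a component that is the over (resp. under) strand at each of its
crossings and has no self-crossing lies entirely above (below) the rest: it is a split unknot and is
discarded from the crossings as one more loose circle), `REVERSE` (reorientation of one component),
`BAND` (orientation-coherent band move = a saddle inside a face, with signed half-twists; same component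
⇒ it splits, different components ⇒ they merge) — then the move type, the replay `run`, the certificate
type `KCert` and **the kernel check** `KCert.check` (start diagram = ONE component; every move replays
with all its preconditions; final state crossingless with exactly `nBands + 1` loose circles = the
`ribbon` terminal condition of `CERT-FORMAT-kirby.md` §4), the replay-soundness statement `Sound` (the
ONE named hypothesis a consumer takes — compared with `ReplaySound` of `RibbonCertificates` the external
replaying program is gone from the trust base: the kernel does the replay), its readings
`isRibbon_of_check` / `sliceObstruction_eq_zero_of_check` / `exotic_of_check`, and a smoke test: the
cell's four-move certificate of the stevedore knot `6_1` ACCEPTED by `decide`.  The certificates of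
record (row 385's `K_G`, Kegel–Spreer's `K₂′`, the rider family) are checked in the sibling files
`KernelReplayCerts` / `KernelReplayRiders`.  Nothing here asserts that a diagram presents a knot;
nothing here is a claim about `S⁴`.

Why `check = true` means ribbon (the content of `Sound`; Gompf–Stipsicz §6.2): `r1m`/`pass`/`float`/
`reverse` are ambient isotopies (or a reorientation) of the presented link and each `band` is a saddle;
`n` saddles carrying a knot `K` to the `(n+1)`-component unlink, capped by `n + 1` discs, give a properly
embedded disc in `B⁴` with only saddles and minima (connected, χ = (n+1) − n = 1, boundary `K`), i.e. a
ribbon disc; in particular `K` is smoothly slice.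

References: R. E. Gompf, A. I. Stipsicz, *4-Manifolds and Kirby Calculus* (1999) §6.2; C. Manolescu,
L. Piccirillo, J. Lond. Math. Soc. (2) 108 (2023) 2001–2036, Thm 1.3; cell spec
`HOME/p3/CERT-FORMAT-kirby.md` §3–§5.
-/

open scoped Manifold ContDiff Topology
open ContinuousMap

namespace Summit.Ventures.SP4Inv.KR

open Literature.Topology.FourManifolds Literature.Topology.FourManifolds.MPCensus

/-! ## 4 (continued). The moves `FLOAT`, `REVERSE`, `BAND` -/

/-- FLOAT worker: every crossing of the component must have it as the `over` (resp. under) strand and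
the other strand outside the component. [folklore] -/
def floatDels (xs : List Xg) (comp : List ℕ) (ov : Bool) : List ℕ → List (ℕ × Keep) →
    Option (List (ℕ × Keep))
  | [], acc => some acc.reverse
  | e :: rest, acc =>
    match findEnd xs e true 0 with
    | none => none
    | some (i, k, x) =>
      let isover : Bool := k == 1 || k == 3
      let other := if isover then x.s0 else x.s1
      if isover ≠ ov ∨ comp.any (· == other) then none
      else floatDels xs comp ov rest ((i, if isover then Keep.lower else Keep.upper) :: acc)

/-- Does an index occur twice? [folklore] -/
def hasDup : List ℕ → Bool
  | [] => false
  | i :: l => l.any (· == i) || hasDup l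

/-- `FLOAT`: the component of edge `c`, lying entirely above (`over`) or below the rest and without
self-crossings, is deleted from the crossings and counted as one more loose circle. [folklore] -/
def floatC (st : St) (c : ℕ) (ov : Bool) : Option St :=
  match componentEdges st.xs c with
  | none => none
  | some comp =>
    match floatDels st.xs comp ov comp [] with
    | none => none
    | some dels =>
      if hasDup (dels.map Prod.fst) then none
      else
        let r := deleteCrossings st.xs dels 0 0
        some ⟨r.1, st.loose + r.2.1 + 1, st.fresh⟩

/-- Reverse the orientation of the component with edge set `comp` at one crossing: the slots rotate by
two when the under strand is in the component, and the sign flips iff exactly one strand is. [folklore] -/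
def revX (comp : List ℕ) (x : Xg) : Xg :=
  let uin := comp.any (· == x.s0)
  let oin := comp.any (· == x.s1)
  let npos := if uin = oin then x.pos else !x.pos
  if uin then ⟨x.s2, x.s3, x.s0, x.s1, npos⟩ else ⟨x.s0, x.s1, x.s2, x.s3, npos⟩

/-- `REVERSE` the component of edge `c` (labels kept). [folklore] -/
def reverseC (st : St) (c : ℕ) : Option St :=
  match componentEdges st.xs c with
  | none => none
  | some comp => some ⟨st.xs.map (revX comp), st.loose, st.fresh⟩

/-- The `k`-th (`1 ≤ k ≤ n`, counted from the `a` side) of the `n` half-twist crossings of a band: the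
descending side has edges `a, fresh, …, fresh+n-1`, the ascending side `b, fresh+n, …, fresh+2n-1`;
they alternate over/under, the first one with the `a` side over iff `tpos`. [folklore] -/
def twistX (a b fresh n : ℕ) (tpos : Bool) (k : ℕ) : Xg :=
  let dp : ℕ → ℕ := fun j => if j = 0 then a else fresh + j - 1
  let up : ℕ → ℕ := fun j => if j = 0 then b else fresh + n + j - 1
  let din := dp (k - 1)
  let dout := dp k
  let uin := up (n - k)
  let uout := up (n - k + 1)
  let kodd : Bool := k % 2 == 1
  let descOver : Bool := if tpos then kodd else !kodd
  if kodd then (if descOver then ⟨uin, dout, uout, din, true⟩ else ⟨din, uin, dout, uout, false⟩)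
  else (if descOver then ⟨uin, din, uout, dout, false⟩ else ⟨din, uout, dout, uin, true⟩)

/-- Insert `n ≥ 1` half-twist crossings between the two new edges of a band. [folklore] -/
def addTwists (st : St) (a b n : ℕ) (tpos : Bool) : Option St :=
  match findEnd st.xs a true 0, findEnd st.xs b true 0 with
  | some (ib, kb, _), some (ia, ka, _) =>
    let f := st.fresh
    let xs1 := setSlot (setSlot st.xs ib kb (f + n - 1)) ia ka (f + 2 * n - 1)
    some ⟨xs1 ++ (List.range n).map (fun j => twistX a b f n tpos (j + 1)), st.loose, f + 2 * n⟩
  | _, _ => none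

/-- `BAND`: orientation-coherent band move between edges `a` and `b` inside the face to the right of
both darts `(a, da)`, `(b, db)`, with `t` signed half-twists: after normalising `da` (reversing the
component of `a`, which flips `db` too when `a`, `b` share a component) `t` must be even iff `db`; the
heads of `a` and `b` are exchanged (`a` now runs to `b`'s old head and conversely), a same-component band
must split the component, `|t|` alternating twist crossings are inserted, and the normalising reversal is
undone on the resulting component(s). [folklore] -/
def band (st : St) (a b : ℕ) (da db : Bool) (t : ℤ) : Option St :=
  if a = b then none
  else if (findEnd st.xs a true 0).isNone ∨ (findEnd st.xs b true 0).isNone then none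
  else if !(sameFace st.xs none none (a, da) (b, db)) then none
  else
    match componentEdges st.xs a with
    | none => none
    | some compa =>
      let same := compa.any (· == b)
      match (if da then some st else reverseC st a) with
      | none => none
      | some st1 =>
        let db' := if da then db else (if same then !db else db)
        let n := t.natAbs
        if (db' ∧ n % 2 = 1) ∨ (!db' ∧ n % 2 = 0) then none
        else
          match findEnd st1.xs a true 0, findEnd st1.xs b true 0 with
          | some (ia, ka, _), some (ib, kb, _) =>
            let xs1 := setSlot (setSlot st1.xs ib kb a) ia ka b
            let splitOK : Bool :=
              if same then
                match componentEdges xs1 b, componentEdges xs1 a with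
                | some cb, some _ => !(cb.any (· == a))
                | _, _ => false
              else true
            if !splitOK then none
            else
              let st2 : St := ⟨xs1, st1.loose, st1.fresh⟩
              match (if n = 0 then some st2 else addTwists st2 a b n (decide (0 < t))) with
              | none => none
              | some st3 =>
                if da then some st3
                else
                  match reverseC st3 a with
                  | none => none
                  | some st4 => if same then reverseC st4 b else some st4
          | _, _ => none

/-! ## 5. Certificates and the kernel check -/

/-- The five moves of a `kirby-cert/1` RIBBON certificate, in this file's labelling: `r1m i` (crossing
index), `pass over es et route` (route = darts `(label, forward?)` of the cut-open diagram), `float c over`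
and `reverse c` (component named by any of its edge labels), `band a b da db t`. [folklore] -/
inductive Move where
  | r1m (i : ℕ)
  | pass (ov : Bool) (es et : ℕ) (route : List (ℕ × Bool))
  | float (c : ℕ) (ov : Bool)
  | reverse (c : ℕ)
  | band (a b : ℕ) (da db : Bool) (t : ℤ)
  deriving DecidableEq, Repr

/-- Is the move a band (a saddle of the eventual ribbon disc)? [folklore] -/
def Move.isBand : Move → Bool
  | .band _ _ _ _ _ => true
  | _ => false

/-- One replay step. [folklore] -/
def step (st : St) : Move → Option St
  | .r1m i => r1m st i
  | .pass ov es et route => pass st ov es et route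
  | .float c ov => floatC st c ov
  | .reverse c => reverseC st c
  | .band a b da db t => band st a b da db t

/-- Replay a move list. [folklore] -/
def run : St → List Move → Option St
  | st, [] => some st
  | st, m :: ms =>
    match step st m with
    | none => none
    | some st' => run st' ms

/-- A kernel ribbon certificate: a start PD code WITH crossing signs (the knot diagram, labels as
printed) and a move list. [folklore] -/
structure KCert where
  /-- the start diagram -/
  start : List Xg
  /-- the moves -/
  moves : List Move
  deriving Repr

namespace KCert

/-- Largest edge label of the start diagram (fresh labels begin above it). [folklore] -/
def maxLabel (c : KCert) : ℕ :=
  c.start.foldl (fun m x => max m (max (max x.s0 x.s1) (max x.s2 x.s3))) 0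

/-- The initial replay state. [folklore] -/
def startSt (c : KCert) : St := ⟨c.start, 0, c.maxLabel + 1⟩

/-- Number of band moves (saddles). [folklore] -/
def nBands (c : KCert) : ℕ := (c.moves.filter Move.isBand).length

/-- **The kernel check** of a ribbon certificate: the start diagram is ONE component, every move replays
(all preconditions hold), and the final state has no crossings and exactly `nBands + 1` loose circles
(terminal condition `ribbon` of `CERT-FORMAT-kirby.md` §4). [folklore] -/
def check (c : KCert) : Bool :=
  isKnot c.start &&
    (match run c.startSt c.moves with
     | none => false
     | some s => s.xs.isEmpty && s.loose == c.nBands + 1)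

end KCert

/-! ## 6. What an accepted certificate gives, stated exactly -/

/-- **The replay-soundness statement for the kernel checker.** `Presents D K` is the (external)
assertion that the signed PD code `D` is a diagram of the knot `K`.  `Sound Presents` says: whenever
the kernel check accepts a certificate whose start diagram presents `K`, the knot `K` is ribbon —
because `r1m`/`pass`/`float`/`reverse` as defined above are ambient isotopies of the presented link
and each `band` is a saddle, so `check = true` exhibits `nBands` saddles carrying `K` to the
`(nBands + 1)`-component unlink, i.e. a ribbon disc (Gompf–Stipsicz §6.2).  This is a definition — the
one named hypothesis a consumer takes — not an assertion; compared with `ReplaySound` of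
`RibbonCertificates` the external replaying program is gone from the trust base. [folklore] -/
def Sound (Presents : List Xg → Knot → Prop) : Prop :=
  ∀ c : KCert, c.check = true → ∀ K : Knot, Presents c.start K → K.IsRibbon

/-- Reading a kernel-accepted certificate through `Sound`: the presented knot is ribbon. [folklore] -/
theorem isRibbon_of_check {Presents : List Xg → Knot → Prop} (hS : Sound Presents)
    {c : KCert} (hc : c.check = true) {K : Knot} (hP : Presents c.start K) : K.IsRibbon :=
  hS c hc K hP

/-- … hence smoothly slice, so every integer invariant with Rasmussen's slice obstruction vanishes on it
(this is how a ribbon certificate for the `s ≠ 0` candidate of a zero-surgery pair retires the pair: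
`exotic_of_ribbon_partner` needs `s ≠ 0` on the partner). [folklore] -/
theorem sliceObstruction_eq_zero_of_check {Presents : List Xg → Knot → Prop} (hS : Sound Presents)
    {c : KCert} (hc : c.check = true) {K : Knot} (hP : Presents c.start K)
    {s : Knot → ℤ} (hRas : SliceObstruction s) : s K = 0 :=
  hRas K (isRibbon_of_check hS hc hP).isSmoothlySlice

/-- The census consequence in the cell's shape: a kernel-accepted ribbon certificate for `K_B`, a common
zero-surgery with `K_G` and `s(K_G) ≠ 0` give an exotic `S⁴` (via `exotic_of_ribbon_partner`, i.e.
MP 2023 Thm 1.3 with `n = 0` as proved in the tree). [cite: ManolescuPiccirillo2023, Thm 1.3 (proof), §1 p. 1] -/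
theorem exotic_of_check {Presents : List Xg → Knot → Prop} (hS : Sound Presents)
    {c : KCert} (hc : c.check = true) {s : Knot → ℤ} (hRas : SliceObstruction s)
    {K_B K_G : Knot} (hP : Presents c.start K_B) (h0 : CommonZeroSurgery K_B K_G) (hs : s K_G ≠ 0) :
    ∃ (M : Type) (_ : TopologicalSpace M) (_ : T2Space M) (_ : SecondCountableTopology M)
      (_ : ChartedSpace (EuclideanSpace ℝ (Fin 4)) M) (_ : IsManifold (𝓡 4) ∞ M) (_ : CompactSpace M),
      Nonempty (M ≃ₕ (Metric.sphere (0 : EuclideanSpace ℝ (Fin 5)) 1)) ∧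
        IsEmpty (M ≃ₘ⟮𝓡 4, 𝓡 4⟯ (Metric.sphere (0 : EuclideanSpace ℝ (Fin 5)) 1)) :=
  exotic_of_ribbon_partner hRas h0 hs (isRibbon_of_check hS hc hP)

/-! ## 7. Smoke test: the stevedore knot `6_1`, accepted by the kernel -/

/-- The cell's four-move ribbon certificate of `6_1` (`HOME/p3/certs/cert_ribbon_6_1.json`, KnotInfo PD
with signs; one band with one negative half-twist, two over-passes, one float), in this file's labelling
(translated by the twin `kreplay.py`). Data only. [folklore] -/
def cert_6_1 : KCert where
  start := [⟨1, 7, 2, 6, true⟩, ⟨3, 10, 4, 11, false⟩, ⟨5, 3, 6, 2, true⟩, ⟨7, 1, 8, 12, true⟩,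
    ⟨9, 4, 10, 5, false⟩, ⟨11, 9, 12, 8, true⟩]
  moves := [.band 8 3 true false (-1), .pass true 2 9 [], .pass true 4 7 [], .float 4 false]

/-- The kernel ACCEPTS the `6_1` certificate: one component at the start, all four moves replay, and the
final state is the crossingless two-component unlink (`1` band `+ 1`). [folklore] -/
theorem cert_6_1_check : cert_6_1.check = true := by decide +kernel

/-! ## 8. The other four table-knot certificates of the cell (`8_8`, `8_20`, `9_46`, `10_137`) -/

/-- The cell's ribbon certificate of the KnotInfo knot `8_8` (`HOME/p3/certs/cert_ribbon_8_8.json`, sha256 `c0ee469461bcf5c3…`; KnotInfo PD with signs; 5 moves: 1 `band`, 3 `pass`, 0 `r1m`, 1 `float`), twin-translated. Data only. [folklore] -/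
def cert_8_8 : KCert where
  start := [⟨1, 7, 2, 6, true⟩, ⟨3, 12, 4, 13, false⟩, ⟨5, 9, 6, 8, true⟩, ⟨7, 3, 8, 2, true⟩, ⟨9, 16, 10, 1, false⟩, ⟨11, 14, 12, 15, false⟩, ⟨13, 4, 14, 5, false⟩, ⟨15, 10, 16, 11, false⟩]
  moves := [.band 7 12 true false (1), .pass true 6 13 [(8, false)], .pass true 16 5 [], .pass true 6 15 [], .float 6 false]

/-- The kernel ACCEPTS the `8_8` certificate. [folklore] -/
theorem cert_8_8_check : cert_8_8.check = true := by decide +kernel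

/-- The cell's ribbon certificate of the KnotInfo knot `8_20` (`HOME/p3/certs/cert_ribbon_8_20.json`, sha256 `3c9f1b15ffd7f529…`; KnotInfo PD with signs; 5 moves: 1 `band`, 2 `pass`, 1 `r1m`, 1 `float`), twin-translated. Data only. [folklore] -/
def cert_8_20 : KCert where
  start := [⟨1, 7, 2, 6, true⟩, ⟨4, 13, 5, 14, false⟩, ⟨5, 9, 6, 8, true⟩, ⟨7, 3, 8, 2, true⟩, ⟨10, 15, 11, 16, false⟩, ⟨12, 9, 13, 10, false⟩, ⟨14, 3, 15, 4, false⟩, ⟨16, 11, 1, 12, false⟩]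
  moves := [.band 7 11 true true (0), .pass true 6 12 [], .pass false 4 13 [], .r1m 2, .float 3 true]

/-- The kernel ACCEPTS the `8_20` certificate. [folklore] -/
theorem cert_8_20_check : cert_8_20.check = true := by decide +kernel

/-- The cell's ribbon certificate of the KnotInfo knot `9_46` (`HOME/p3/certs/cert_ribbon_9_46.json`, sha256 `a0d3a6da62c474c4…`; KnotInfo PD with signs; 7 moves: 1 `band`, 2 `pass`, 3 `r1m`, 1 `float`), twin-translated. Data only. [folklore] -/
def cert_9_46 : KCert where
  start := [⟨2, 10, 3, 9, true⟩, ⟨3, 14, 4, 15, false⟩, ⟨6, 17, 7, 18, false⟩, ⟨8, 11, 9, 12, false⟩, ⟨10, 2, 11, 1, true⟩, ⟨13, 4, 14, 5, false⟩, ⟨15, 13, 16, 12, true⟩, ⟨16, 7, 17, 8, false⟩, ⟨18, 5, 1, 6, false⟩]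
  moves := [.band 1 5 true true (0), .r1m 8, .r1m 2, .r1m 6, .pass true 11 13 [], .pass true 4 2 [], .float 10 true]

/-- The kernel ACCEPTS the `9_46` certificate. [folklore] -/
theorem cert_9_46_check : cert_9_46.check = true := by decide +kernel

/-- The cell's ribbon certificate of the KnotInfo knot `10_137` (`HOME/p3/certs/cert_ribbon_10_137.json`, sha256 `e999ecc990d68fae…`; KnotInfo PD with signs; 7 moves: 1 `band`, 3 `pass`, 2 `r1m`, 1 `float`), twin-translated. Data only. [folklore] -/
def cert_10_137 : KCert where
  start := [⟨1, 15, 2, 14, true⟩, ⟨4, 8, 5, 7, true⟩, ⟨6, 19, 7, 20, false⟩, ⟨9, 17, 10, 16, true⟩, ⟨11, 8, 12, 9, false⟩, ⟨13, 3, 14, 2, true⟩, ⟨15, 11, 16, 10, true⟩, ⟨17, 12, 18, 13, false⟩, ⟨18, 4, 19, 3, true⟩, ⟨20, 5, 1, 6, false⟩]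
  moves := [.band 1 15 true true (0), .r1m 0, .r1m 4, .pass true 12 4 [], .pass true 7 9 [], .pass true 10 6 [], .float 17 true]

/-- The kernel ACCEPTS the `10_137` certificate. [folklore] -/
theorem cert_10_137_check : cert_10_137.check = true := by decide +kernel

end Summit.Ventures.SP4Inv.KR
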